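import Mathlib
import Summits.NavierStokesRegularity.FluidComputer.APosterioriInverseBound

/-!
# Certifier norm bounds, supplement 2: `θ = ‖1 − X̃Â₀‖₂ < 1` ⇒ the complex head matrix is invertible, with `‖Â₀⁻¹‖₂ ≤ ‖X̃‖₂/(1 − θ)` (profile-cert-3 g3, cell `ns-blowup`, 2026-08-26)

HONEST FRAMING (human rulings D-0035/D-0074): nothing here is a claim about Navier–Stokes blow-up.
WHAT THIS IS NOT: not NS evidence. Supplement to `CertifierNormBounds.lean` (same namespace): hypothesis (H1) of
THEOREM 3-B / (N3) of cap `SKEWCUT-PAIR.md` §9 as used by all three F5 implementations — the bordered head `Â₀` is a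
COMPLEX matrix (class bases over `ℤ[i]`), the float inverse proposal `X̃` is verified by `θ := ‖1 − X̃Â₀‖₂ < 1`
(impl-3: `θ = √(‖E‖₁‖E‖_∞)`, kernel `CertifierNormBounds.l2_opNorm_le_sqrt_rowSum_mul_colSum`), and then
`α₀ := ‖X̃‖₂/(1 − θ) ≥ ‖Â₀⁻¹‖₂`. The real `ℓ²` and real `ℓ^∞` versions of the invertibility step are
`SkewCutRelaxedEnclosure.isUnit_det_of_l2_opNorm_one_sub_mul_lt` (instab3) and
`SkewCutAPosteriori.isUnit_det_of_norm_one_sub_mul_lt` (selfsim); the norm bound in any normed ring is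
`APosterioriInverseBound.Units.norm_inv_le` (cap). Here: the version over `ℝ` or `ℂ` (`RCLike`) in the
`ℓ²`-operator norm, invertibility included.

* `isUnit_det_of_l2_opNorm_one_sub_mul_lt` — `‖1 − R A‖₂ < 1` ⇒ `det A ≠ 0` (Neumann: `R A = 1 − (1 − R A)` is a
  unit of the Banach algebra `Matrix n n 𝕜`, hence `det R · det A ≠ 0`).
* `l2_opNorm_inv_le_of_one_sub_mul_lt` — then `‖A⁻¹‖₂ ≤ ‖R‖₂/(1 − ‖1 − R A‖₂)`.

Mathlib + `APosterioriInverseBound`; no new definitions. bears_on LADDER-NS N5 / Z4-a(1)(2) (F5 certificate rigour);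
evidence-only for route item `EpisodeBase` (stmt-NavierStokesRegularity-19179).
-/

open scoped Matrix.Norms.L2Operator

namespace Summit.NavierStokesRegularity.FluidComputer.CertifierNormBounds

open Summit.NavierStokesRegularity.FluidComputer.APosterioriInverseBound

section HeadUnit

variable {𝕜 : Type*} [RCLike 𝕜] {n : Type*} [Fintype n] [DecidableEq n]

/-- **(H1): Rump's test in the spectral norm, over `ℝ` or `ℂ`.** For square matrices `R`, `A` with
`‖1 − R A‖₂ < 1`, `A` is nonsingular. [folklore] -/
theorem isUnit_det_of_l2_opNorm_one_sub_mul_lt (R A : Matrix n n 𝕜) (h : ‖1 - R * A‖ < 1) :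
    IsUnit A.det := by
  -- `R * A = 1 - (1 - R * A)` is a unit of the complete normed ring `Matrix n n 𝕜`
  have hu : IsUnit (R * A) := by
    have := (Units.oneSub (1 - R * A) h).isUnit
    rwa [Units.val_oneSub, sub_sub_cancel] at this
  rw [Matrix.isUnit_iff_isUnit_det, Matrix.det_mul] at hu
  exact isUnit_of_mul_isUnit_right hu

/-- **(H1) ⇒ `α₀`.** Under `θ := ‖1 − R A‖₂ < 1`: `‖A⁻¹‖₂ ≤ ‖R‖₂/(1 − θ)` (the certifiers' `α₀ = ‖X̃‖₂/(1 − θ)`).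
[folklore] -/
theorem l2_opNorm_inv_le_of_one_sub_mul_lt (R A : Matrix n n 𝕜) (h : ‖1 - R * A‖ < 1) :
    ‖A⁻¹‖ ≤ ‖R‖ / (1 - ‖1 - R * A‖) := by
  have hA : IsUnit A.det := isUnit_det_of_l2_opNorm_one_sub_mul_lt R A h
  have hAu : IsUnit A := (Matrix.isUnit_iff_isUnit_det A).mpr hA
  obtain ⟨u, hu⟩ := hAu
  have hinv : A⁻¹ = (↑u⁻¹ : Matrix n n 𝕜) := by
    rw [← hu, Matrix.coe_units_inv]
  have h' : ‖1 - R * (u : Matrix n n 𝕜)‖ < 1 := by rwa [hu]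
  have := Units.norm_inv_le u R h'
  rw [hinv]
  simpa [hu] using this

end HeadUnit

end Summit.NavierStokesRegularity.FluidComputer.CertifierNormBounds
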